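import Summits.Ventures.LatticeQCDFlow.Scaling.SectorExactStaleSet

/-!
HONEST FRAMING: exact (Metropolis-corrected) sampling algorithms for lattice gauge theory; figures
of merit are autocorrelation/cost numbers at stated couplings and volumes; no continuum-physics
claim.

# SectorExactAveragedStaleSet — THE DRIFT OF THE STALE POTENTIAL OF THE PARTITION-EXACT AUGMENTATION WITH THE EXACT ENTRY GAIN, AND
# THE AVERAGED ACCEPTANCE UNDER ONE-SIDED DOMINATION `p·μ_{κ_r+1}(φ_r u) ≤ μ_0(u)` (GENERAL `S`, ANY MAPS): AFTER A HOT REDRAW THE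
# ENTRY OF A STALE COLD LEVEL IS ACCEPTED WITH MEAN PROBABILITY `≥ p`; THE REDRAW BRANCH OF `P̂` CARRIES THE GAIN (lean-2 GEN-30, ours)

Venture-side (OURS).  Cell `lqcd-flow` (pub-lqcd), unit `pub-lqcd-lean-2-g30`, 2026-08-28.  Chapter Q (item 1 for sector-exact maps on a
general `S`), file 12.  `Scaling/SectorExactStaleSet` contracts the stale potential `Ψ(D) = θ𝟙{0∈D} + #(D∖{0})` of the augmentation
`P̂` of `Scaling/SectorExactAugmentation` at the rate `(1−θ)·a·ct/m`, `a` a floor for EVERY entry acceptance — for two sectors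
`a = min_r min{1, cin_r/cout_r, cout_r/cin_r}`, a quantity of the sector weights that the domination constant does not control.  This file
and the next remove `a` exactly as `Scaling/BooleanStarAveragedDrift` ∕ `…TwoStepContraction` did for the label chain: under one-sided
domination the entry that would carry the hub content `z_0` to level `l` is accepted with probability `≥ p·μ_l(φ_r z_0)/μ_0(z_0)`
(`dom_accept_ge`, general `S`, any maps), so after a hot redraw the mean acceptance is `Σ_v μ_0(v)·α_r(z^{0↦v}) ≥ p·Σ_v μ_l(φ_r v) = p`
(`sum_redraw_accept_ge_dom`).

## What is proved

* §6 `dom_accept_ge`, `sum_redraw_accept_ge_dom` (general `S`, any entry maps, one-sided domination, laws summing to one);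
  **`sectorAug_step_stalePotential_le_gain`** — `Σ_b P̂(a,b)Ψ(b.2) ≤ Ψ(a.2) − G(a)`, `G(z,D) = (1−θ)(t/m)Σ_r α_r(z)𝟙{κ_r+1 ∈ D}` if `0 ∉ D`,
  `(1−t)w_0θ − (1−θ)t` if `0 ∈ D`; `sectorAug_gain_nonneg`; **`sectorAug_sum_gain_ge`** — for `0 ∉ D`,
  `Σ_b P̂((z,D),b)G(b) ≥ (1−t)w_0·(1−θ)(t/m)·p·Σ_r 𝟙{κ_r+1 ∈ D}` (every branch of `P̂` is a non-negative weight times `G ≥ 0`; the hot-redraw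
  branch alone gives `(1−t)w_0·Σ_v μ_0(v)G(z^{0↦v}, D)`).

NOT CLAIMED here: the two-step contraction and the decay of the stale mass (file 12b `Scaling/SectorExactTwoStepStaleSet`), the law (file 13).
Literature grade (cell rule): OWN; nothing cited as a fact; no new bib keys.
-/
noncomputable section

open Finset Function
open Literature.Probability.MarkovChains

namespace Summit.Ventures.LatticeQCDFlow.Scaling

variable {S : Type*} [Fintype S] [DecidableEq S] {K m : ℕ} {μ : Fin (K + 1) → S → ℝ} {M : Fin (K + 1) → S → S → ℝ}
  {w : Fin (K + 1) → ℝ} {t : ℝ}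

section AvgStale
variable (κ : Fin m → Fin K) (φ : Fin m → Equiv.Perm S)

/-! ## §6 The stale potential contracts over two steps under one-sided domination -/

omit [DecidableEq S] in
/-- **Acceptance under one-sided domination (general `S`, any entry maps):** if `p·μ_{κ_r+1}(φ_r u) ≤ μ_0(u)` for all `r, u`, then
**`p·μ_l(φ_r z_0) ≤ μ_0(z_0)·α_r(z)`** (`l = κ_r+1`): the entry that would carry the hub content to level `l` is accepted with probability
at least `p·μ_l(φ_r z_0)/μ_0(z_0)` (both arguments of `α_r(z)·μ_0(z_0)μ_l(z_l) = min{μ_0(z_0)μ_l(z_l), μ_0(φ_r⁻¹z_l)μ_l(φ_r z_0)}` are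
`≥ p·μ_l(φ_r z_0)·μ_l(z_l)`). [ours] -/
theorem dom_accept_ge (hμ : ∀ k x, 0 < μ k x) {α : Fin m → (Fin (K + 1) → S) → ℝ}
    (hα : ∀ r z, α r z = min 1 (tensorFun μ (edgeFlowSwap (φ r) 0 (κ r).succ z) / tensorFun μ z))
    {p : ℝ} (hdom : ∀ r u, p * μ (κ r).succ (φ r u) ≤ μ 0 u) (r : Fin m) (z : Fin (K + 1) → S) :
    p * μ (κ r).succ (φ r (z 0)) ≤ μ 0 (z 0) * α r z := by
  have h := accept_mul_pair κ φ hμ hα r z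
  have hl : 0 < μ (κ r).succ (z (κ r).succ) := hμ _ _
  have h1 := hdom r (z 0)
  have h2 := hdom r ((φ r).symm (z (κ r).succ))
  rw [Equiv.apply_symm_apply] at h2
  have key : p * μ (κ r).succ (φ r (z 0)) * μ (κ r).succ (z (κ r).succ)
      ≤ μ 0 (z 0) * α r z * μ (κ r).succ (z (κ r).succ) := by
    have e : μ 0 (z 0) * α r z * μ (κ r).succ (z (κ r).succ)
        = min (μ 0 (z 0) * μ (κ r).succ (z (κ r).succ)) (μ 0 ((φ r).symm (z (κ r).succ)) * μ (κ r).succ (φ r (z 0))) := by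
      rw [← h]; ring
    rw [e]
    refine le_min ?_ ?_
    · exact mul_le_mul_of_nonneg_right h1 hl.le
    · calc p * μ (κ r).succ (φ r (z 0)) * μ (κ r).succ (z (κ r).succ)
          = p * μ (κ r).succ (z (κ r).succ) * μ (κ r).succ (φ r (z 0)) := by ring
        _ ≤ μ 0 ((φ r).symm (z (κ r).succ)) * μ (κ r).succ (φ r (z 0)) := mul_le_mul_of_nonneg_right h2 (hμ _ _).le
  exact le_of_mul_le_mul_right key hl

omit [DecidableEq S] in
/-- **The averaged acceptance after a hot redraw is `≥ p`:** `Σ_v μ_0(v)·α_r(z^{0↦v}) ≥ p·Σ_v μ_{κ_r+1}(φ_r v) = p` (one-sided domination,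
`φ_r` a bijection, `Σ μ_{κ_r+1} = 1`). [ours] -/
theorem sum_redraw_accept_ge_dom (hμ : ∀ k x, 0 < μ k x) (hμ1 : ∀ k, ∑ u, μ k u = 1) {α : Fin m → (Fin (K + 1) → S) → ℝ}
    (hα : ∀ r z, α r z = min 1 (tensorFun μ (edgeFlowSwap (φ r) 0 (κ r).succ z) / tensorFun μ z))
    {p : ℝ} (hdom : ∀ r u, p * μ (κ r).succ (φ r u) ≤ μ 0 u) (r : Fin m) (z : Fin (K + 1) → S) :
    p ≤ ∑ v, μ 0 v * α r (update z 0 v) := by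
  calc p = p * ∑ v, μ (κ r).succ (φ r v) := by rw [Equiv.sum_comp (φ r) (fun u => μ (κ r).succ u), hμ1, mul_one]
    _ = ∑ v, p * μ (κ r).succ (φ r v) := by rw [Finset.mul_sum]
    _ ≤ ∑ v, μ 0 v * α r (update z 0 v) := sum_le_sum fun v _ => by
        have h := dom_accept_ge κ φ hμ hα hdom r (update z 0 v)
        rwa [update_self] at h

/-- **THE DRIFT OF THE STALE POTENTIAL WITH THE EXACT ENTRY GAIN:** `Σ_b P̂(a,b)Ψ(b.2) ≤ Ψ(a.2) − G(a)` with
`G(z,D) = (1−θ)(t/m)·Σ_r α_r(z)·𝟙{κ_r+1 ∈ D}` if `0 ∉ D` and `G(z,D) = (1−t)w_0θ − (1−θ)t` if `0 ∈ D` (`0 ≤ θ ≤ 1`, `t ≥ 0`, `Σw = 1`,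
`M_k` row-stochastic, `μ > 0`; no floor, no regime). [ours] -/
theorem sectorAug_step_stalePotential_le_gain (hm : 1 ≤ m) (ht0 : 0 ≤ t) (hw1 : ∑ k, w k = 1)
    (hM : ∀ k, IsRowStochastic (M k)) (hμ : ∀ k x, 0 < μ k x)
    {α : Fin m → (Fin (K + 1) → S) → ℝ}
    (hα : ∀ r z, α r z = min 1 (tensorFun μ (edgeFlowSwap (φ r) 0 (κ r).succ z) / tensorFun μ z))
    {θ : ℝ} (hθ1 : θ ≤ 1)
    {Ψ : Finset (Fin (K + 1)) → ℝ}
    (hΨ : ∀ D, Ψ D = ∑ k : Fin (K + 1), (if k = 0 then θ else 1) * (if k ∈ D then (1 : ℝ) else 0))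
    {G : (Fin (K + 1) → S) × Finset (Fin (K + 1)) → ℝ}
    (hG : ∀ a, G a = if (0 : Fin (K + 1)) ∈ a.2 then (1 - t) * w 0 * θ - (1 - θ) * t
      else (1 - θ) * (t / m) * ∑ r : Fin m, α r a.1 * (if (κ r).succ ∈ a.2 then (1 : ℝ) else 0))
    {Ph : (Fin (K + 1) → S) × Finset (Fin (K + 1)) → (Fin (K + 1) → S) × Finset (Fin (K + 1)) → ℝ}
    (hPh : ∀ a b, Ph a b = ∑ r : Fin m, t / m *
        ((fun r a => α r a.1) r a * (if b.1 = edgeFlowSwap (φ r) 0 (κ r).succ a.1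
            ∧ b.2 = a.2.image (Equiv.swap (0 : Fin (K + 1)) (κ r).succ) then (1 : ℝ) else 0)
          + (α r a.1 - (fun r a => α r a.1) r a) * (if b.1 = edgeFlowSwap (φ r) 0 (κ r).succ a.1
            ∧ b.2 = (fun (_ : Fin m) (D : Finset (Fin (K + 1))) => D) r a.2 then (1 : ℝ) else 0)
          + (1 - α r a.1) * (if b.1 = a.1 ∧ b.2 = (fun (_ : Fin m) (D : Finset (Fin (K + 1))) => D) r a.2 then (1 : ℝ) else 0))
      + (1 - t) * ∑ k : Fin (K + 1), w k * (coordKernel M k a.1 b.1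
          * (if b.2 = (if k = 0 then a.2.erase 0 else a.2) then (1 : ℝ) else 0)))
    (a₀ : (Fin (K + 1) → S) × Finset (Fin (K + 1))) :
    ∑ b, Ph a₀ b * Ψ b.2 ≤ Ψ a₀.2 - G a₀ := by
  obtain ⟨z, D⟩ := a₀
  have hmpos : (0 : ℝ) < m := Nat.cast_pos.mpr (by omega)
  have hacc := accept_mem κ φ hμ hα
  -- the expected potential after one step, in closed form (as in `sectorAug_step_stalePotential_le`)
  have hcK : ∀ k : Fin (K + 1), ∑ b1 : Fin (K + 1) → S, coordKernel M k z b1 = 1 := fun k => by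
    have h := sum_coordKernel_mul M k z (fun _ => (1 : ℝ)); simp only [mul_one] at h; rw [h, (hM k).2]
  have hI : ∀ (y : Fin (K + 1) → S) (E : Finset (Fin (K + 1))),
      ∑ b : (Fin (K + 1) → S) × Finset (Fin (K + 1)), (if b.1 = y ∧ b.2 = E then (1 : ℝ) else 0) * Ψ b.2 = Ψ E := by
    intro y E
    rw [Finset.sum_eq_single (y, E)]
    · simp
    · rintro b - hb; rw [if_neg, zero_mul]; rintro ⟨h1, h2⟩; exact hb (Prod.ext h1 h2)
    · intro h; exact absurd (mem_univ _) h
  have hJ : ∀ (k : Fin (K + 1)) (E : Finset (Fin (K + 1))),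
      ∑ b : (Fin (K + 1) → S) × Finset (Fin (K + 1)), (coordKernel M k z b.1 * (if b.2 = E then (1 : ℝ) else 0)) * Ψ b.2 = Ψ E := by
    intro k E
    rw [Fintype.sum_prod_type]
    simp_rw [mul_assoc, ← Finset.mul_sum, ite_mul, one_mul, zero_mul, Finset.sum_ite_eq' univ E, if_pos (mem_univ _)]
    rw [← Finset.sum_mul, hcK k, one_mul]
  have hexp : ∑ b, Ph (z, D) b * Ψ b.2
      = ∑ r : Fin m, t / m * (α r z * Ψ (D.image (Equiv.swap (0 : Fin (K + 1)) (κ r).succ)) + (1 - α r z) * Ψ D)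
        + ∑ k : Fin (K + 1), ((1 - t) * w k) * Ψ (if k = 0 then D.erase 0 else D) := by
    have hsplit : ∑ b, Ph (z, D) b * Ψ b.2
        = ∑ b : (Fin (K + 1) → S) × Finset (Fin (K + 1)), (∑ r : Fin m, t / m *
            (α r z * (if b.1 = edgeFlowSwap (φ r) 0 (κ r).succ z ∧ b.2 = D.image (Equiv.swap (0 : Fin (K + 1)) (κ r).succ)
                then (1 : ℝ) else 0)
              + (1 - α r z) * (if b.1 = z ∧ b.2 = D then (1 : ℝ) else 0))) * Ψ b.2
          + ∑ b : (Fin (K + 1) → S) × Finset (Fin (K + 1)), (∑ k : Fin (K + 1), ((1 - t) * w k) *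
            (coordKernel M k z b.1 * (if b.2 = (if k = 0 then D.erase 0 else D) then (1 : ℝ) else 0))) * Ψ b.2 := by
      rw [← Finset.sum_add_distrib]
      refine sum_congr rfl fun b _ => ?_
      rw [hPh, ← add_mul]
      dsimp only
      congr 2
      · exact sum_congr rfl fun r _ => by ring
      · rw [Finset.mul_sum]; exact sum_congr rfl fun k _ => by ring
    rw [hsplit, sum_mixture_mul, sum_mixture_mul]
    congr 1
    · refine sum_congr rfl fun r _ => ?_
      congr 1
      simp_rw [add_mul, Finset.sum_add_distrib, mul_assoc, ← Finset.mul_sum, hI]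
    · refine sum_congr rfl fun k _ => ?_
      rw [hJ]
  rw [hexp]
  have hupd : ∑ k : Fin (K + 1), ((1 - t) * w k) * Ψ (if k = 0 then D.erase 0 else D)
      = (1 - t) * Ψ D - (1 - t) * w 0 * θ * (if (0 : Fin (K + 1)) ∈ D then (1 : ℝ) else 0) := by
    rw [Fin.sum_univ_succ, if_pos rfl, stalePotential_erase hΨ]
    simp_rw [if_neg (Fin.succ_ne_zero _)]
    have hw : w 0 + ∑ j : Fin K, w j.succ = 1 := by rw [← Fin.sum_univ_succ]; exact hw1
    rw [← Finset.sum_mul]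
    have : ∑ j : Fin K, (1 - t) * w j.succ = (1 - t) * (1 - w 0) := by rw [← Finset.mul_sum]; congr 1; linarith
    rw [this]; ring
  rw [hupd, hG]
  have htsum : ∑ _r : Fin m, t / m * Ψ D = t * Ψ D := by rw [sum_const, card_univ, Fintype.card_fin, nsmul_eq_mul]; field_simp
  by_cases h0 : (0 : Fin (K + 1)) ∈ D
  · -- the hub is stale: escape at rate `≤ t`, death at rate `(1−t)w_0`
    have hswap : ∀ r : Fin m, α r z * Ψ (D.image (Equiv.swap (0 : Fin (K + 1)) (κ r).succ)) + (1 - α r z) * Ψ D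
        ≤ Ψ D + (1 - θ) := by
      intro r
      rw [stalePotential_swap κ hΨ r D, if_pos h0]
      have h1 : (if (κ r).succ ∈ D then (1 : ℝ) else 0) ≤ 1 := by split_ifs <;> norm_num
      have h2 : 0 ≤ (if (κ r).succ ∈ D then (1 : ℝ) else 0) := by split_ifs <;> norm_num
      have hai : α r z * (1 - (if (κ r).succ ∈ D then (1 : ℝ) else 0)) ≤ 1 := by
        calc α r z * (1 - (if (κ r).succ ∈ D then (1 : ℝ) else 0)) ≤ 1 * 1 :=
              mul_le_mul (hacc r z).2 (by linarith) (by linarith) zero_le_one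
          _ = 1 := one_mul 1
      have key : α r z * (Ψ D + θ * ((if (κ r).succ ∈ D then (1 : ℝ) else 0) - 1) + (1 - (if (κ r).succ ∈ D then (1 : ℝ) else 0)))
          + (1 - α r z) * Ψ D = Ψ D + (α r z * (1 - (if (κ r).succ ∈ D then (1 : ℝ) else 0))) * (1 - θ) := by ring
      rw [key]
      nlinarith [mul_le_mul_of_nonneg_right hai (sub_nonneg.mpr hθ1)]
    have h1 : ∑ r : Fin m, t / m * (α r z * Ψ (D.image (Equiv.swap (0 : Fin (K + 1)) (κ r).succ)) + (1 - α r z) * Ψ D)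
        ≤ t * Ψ D + t * (1 - θ) := by
      calc _ ≤ ∑ _r : Fin m, t / m * (Ψ D + (1 - θ)) := sum_le_sum fun r _ => mul_le_mul_of_nonneg_left (hswap r) (by positivity)
        _ = t * Ψ D + t * (1 - θ) := by rw [sum_const, card_univ, Fintype.card_fin, nsmul_eq_mul]; field_simp
    simp only [h0, if_true, mul_one]
    linarith [h1]
  · -- the hub is fresh: every stale cold unit is pushed to the hub with its own acceptance
    have hswap : ∀ r : Fin m, α r z * Ψ (D.image (Equiv.swap (0 : Fin (K + 1)) (κ r).succ)) + (1 - α r z) * Ψ D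
        = Ψ D - (1 - θ) * (α r z * (if (κ r).succ ∈ D then (1 : ℝ) else 0)) := by
      intro r
      rw [stalePotential_swap κ hΨ r D, if_neg h0]
      ring
    have h1 : ∑ r : Fin m, t / m * (α r z * Ψ (D.image (Equiv.swap (0 : Fin (K + 1)) (κ r).succ)) + (1 - α r z) * Ψ D)
        = t * Ψ D - (1 - θ) * (t / m) * ∑ r : Fin m, α r z * (if (κ r).succ ∈ D then (1 : ℝ) else 0) := by
      simp_rw [hswap, mul_sub, Finset.sum_sub_distrib, htsum, ← Finset.mul_sum]
      ring
    simp only [h0, if_false, mul_zero, sub_zero]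
    rw [h1]
    linarith

omit [DecidableEq S] in
/-- The gain is non-negative under `(1−θ)t ≤ (1−t)w_0·θ` (`θ ≤ 1`, `t ≥ 0`, `μ > 0`). [ours] -/
theorem sectorAug_gain_nonneg (hμ : ∀ k x, 0 < μ k x) (ht0 : 0 ≤ t) {θ : ℝ} (hθ1 : θ ≤ 1) (hreg : (1 - θ) * t ≤ (1 - t) * w 0 * θ)
    {α : Fin m → (Fin (K + 1) → S) → ℝ}
    (hα : ∀ r z, α r z = min 1 (tensorFun μ (edgeFlowSwap (φ r) 0 (κ r).succ z) / tensorFun μ z))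
    {G : (Fin (K + 1) → S) × Finset (Fin (K + 1)) → ℝ}
    (hG : ∀ a, G a = if (0 : Fin (K + 1)) ∈ a.2 then (1 - t) * w 0 * θ - (1 - θ) * t
      else (1 - θ) * (t / m) * ∑ r : Fin m, α r a.1 * (if (κ r).succ ∈ a.2 then (1 : ℝ) else 0))
    (a : (Fin (K + 1) → S) × Finset (Fin (K + 1))) : 0 ≤ G a := by
  have hacc := accept_mem κ φ hμ hα
  rw [hG]
  split_ifs
  · linarith
  · exact mul_nonneg (mul_nonneg (sub_nonneg.mpr hθ1) (div_nonneg ht0 (Nat.cast_nonneg _)))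
      (sum_nonneg fun r _ => mul_nonneg (hacc r _).1 (by split_ifs <;> norm_num))

/-- **The redraw branch of `P̂` carries the gain:** if the hub is fresh (`0 ∉ D`), then under one-sided domination
**`Σ_b P̂((z,D),b)G(b) ≥ (1−t)w_0·(1−θ)(t/m)·p·Σ_r 𝟙{κ_r+1 ∈ D}`** — every branch of `P̂` is a non-negative weight times `G ≥ 0`, the
hot-redraw branch alone gives `(1−t)w_0·Σ_v μ_0(v)·G(z^{0↦v}, D)`, and its entry gains average to `≥ p` per listed stale level. [ours] -/
theorem sectorAug_sum_gain_ge (ht0 : 0 ≤ t) (ht1 : t ≤ 1) (hw0 : ∀ k, 0 ≤ w k)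
    (hM : ∀ k, IsRowStochastic (M k)) (hM0 : ∀ u v, M 0 u v = μ 0 v) (hμ : ∀ k x, 0 < μ k x) (hμ1 : ∀ k, ∑ u, μ k u = 1)
    {α : Fin m → (Fin (K + 1) → S) → ℝ}
    (hα : ∀ r z, α r z = min 1 (tensorFun μ (edgeFlowSwap (φ r) 0 (κ r).succ z) / tensorFun μ z))
    {p : ℝ} (hdom : ∀ r u, p * μ (κ r).succ (φ r u) ≤ μ 0 u)
    {θ : ℝ} (hθ1 : θ ≤ 1) (hreg : (1 - θ) * t ≤ (1 - t) * w 0 * θ)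
    {G : (Fin (K + 1) → S) × Finset (Fin (K + 1)) → ℝ}
    (hG : ∀ a, G a = if (0 : Fin (K + 1)) ∈ a.2 then (1 - t) * w 0 * θ - (1 - θ) * t
      else (1 - θ) * (t / m) * ∑ r : Fin m, α r a.1 * (if (κ r).succ ∈ a.2 then (1 : ℝ) else 0))
    {Ph : (Fin (K + 1) → S) × Finset (Fin (K + 1)) → (Fin (K + 1) → S) × Finset (Fin (K + 1)) → ℝ}
    (hPh : ∀ a b, Ph a b = ∑ r : Fin m, t / m *
        ((fun r a => α r a.1) r a * (if b.1 = edgeFlowSwap (φ r) 0 (κ r).succ a.1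
            ∧ b.2 = a.2.image (Equiv.swap (0 : Fin (K + 1)) (κ r).succ) then (1 : ℝ) else 0)
          + (α r a.1 - (fun r a => α r a.1) r a) * (if b.1 = edgeFlowSwap (φ r) 0 (κ r).succ a.1
            ∧ b.2 = (fun (_ : Fin m) (D : Finset (Fin (K + 1))) => D) r a.2 then (1 : ℝ) else 0)
          + (1 - α r a.1) * (if b.1 = a.1 ∧ b.2 = (fun (_ : Fin m) (D : Finset (Fin (K + 1))) => D) r a.2 then (1 : ℝ) else 0))
      + (1 - t) * ∑ k : Fin (K + 1), w k * (coordKernel M k a.1 b.1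
          * (if b.2 = (if k = 0 then a.2.erase 0 else a.2) then (1 : ℝ) else 0)))
    (z : Fin (K + 1) → S) {D : Finset (Fin (K + 1))} (h0 : (0 : Fin (K + 1)) ∉ D) :
    (1 - t) * w 0 * ((1 - θ) * (t / m) * p * ∑ r : Fin m, (if (κ r).succ ∈ D then (1 : ℝ) else 0))
      ≤ ∑ b, Ph (z, D) b * G b := by
  have hG0 := sectorAug_gain_nonneg κ φ hμ ht0 hθ1 hreg hα hG
  have hacc := accept_mem κ φ hμ hα
  have hcK0 : ∀ k b1, 0 ≤ coordKernel M k z b1 := fun k b1 => coordKernel_nonneg M (fun j u v => (hM j).1 u v) k z b1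
  have hDe : D.erase 0 = D := Finset.erase_eq_self.mpr h0
  -- keep only the hot-redraw branch
  have hbranch : ∀ b : (Fin (K + 1) → S) × Finset (Fin (K + 1)),
      (1 - t) * w 0 * (coordKernel M 0 z b.1 * (if b.2 = D then (1 : ℝ) else 0)) ≤ Ph (z, D) b := by
    intro b
    rw [hPh]
    dsimp only
    rw [hDe]
    have hent : 0 ≤ ∑ r : Fin m, t / m *
        (α r z * (if b.1 = edgeFlowSwap (φ r) 0 (κ r).succ z ∧ b.2 = D.image (Equiv.swap (0 : Fin (K + 1)) (κ r).succ)
            then (1 : ℝ) else 0)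
          + (α r z - α r z) * (if b.1 = edgeFlowSwap (φ r) 0 (κ r).succ z ∧ b.2 = D then (1 : ℝ) else 0)
          + (1 - α r z) * (if b.1 = z ∧ b.2 = D then (1 : ℝ) else 0)) :=
      sum_nonneg fun r _ => mul_nonneg (div_nonneg ht0 (Nat.cast_nonneg _))
        (add_nonneg (add_nonneg (mul_nonneg (hacc r z).1 (by split_ifs <;> norm_num))
          (by rw [sub_self, zero_mul])) (mul_nonneg (sub_nonneg.mpr (hacc r z).2) (by split_ifs <;> norm_num)))
    have hup : w 0 * (coordKernel M 0 z b.1 * (if b.2 = D then (1 : ℝ) else 0))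
        ≤ ∑ k : Fin (K + 1), w k * (coordKernel M k z b.1 * (if b.2 = (if k = 0 then D else D) then (1 : ℝ) else 0)) := by
      have h := Finset.single_le_sum (f := fun k : Fin (K + 1) =>
          w k * (coordKernel M k z b.1 * (if b.2 = (if k = 0 then D else D) then (1 : ℝ) else 0)))
        (fun k _ => mul_nonneg (hw0 k) (mul_nonneg (hcK0 k _) (by split_ifs <;> norm_num))) (mem_univ 0)
      simp only [if_true] at h
      simpa only [ite_self] using h
    have := mul_le_mul_of_nonneg_left hup (show (0 : ℝ) ≤ 1 - t by linarith)
    rw [← mul_assoc] at this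
    linarith
  -- the hot-redraw branch in closed form
  have hred : ∑ b : (Fin (K + 1) → S) × Finset (Fin (K + 1)),
      (1 - t) * w 0 * (coordKernel M 0 z b.1 * (if b.2 = D then (1 : ℝ) else 0)) * G b
      = (1 - t) * w 0 * ∑ v, μ 0 v * G (update z 0 v, D) := by
    rw [Fintype.sum_prod_type]
    have hin : ∀ b1 : Fin (K + 1) → S, ∑ b2 : Finset (Fin (K + 1)),
        (1 - t) * w 0 * (coordKernel M 0 z b1 * (if b2 = D then (1 : ℝ) else 0)) * G (b1, b2)
        = (1 - t) * w 0 * (coordKernel M 0 z b1 * G (b1, D)) := by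
      intro b1
      rw [Finset.sum_eq_single D (fun b2 _ hb2 => by rw [if_neg hb2, mul_zero, mul_zero, zero_mul])
        (fun h => absurd (mem_univ _) h), if_pos rfl, mul_one]
      ring
    simp_rw [hin]
    rw [← Finset.mul_sum, sum_coordKernel_mul M 0 z (fun b1 => G (b1, D))]
    simp_rw [hM0]
  -- the redrawn gains average to `≥ p` per listed stale level
  have hGv : ∀ v, G (update z 0 v, D) = (1 - θ) * (t / m) * ∑ r : Fin m, α r (update z 0 v) * (if (κ r).succ ∈ D then (1 : ℝ) else 0) :=
    fun v => by rw [hG]; exact if_neg h0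
  have havg : (1 - θ) * (t / m) * p * ∑ r : Fin m, (if (κ r).succ ∈ D then (1 : ℝ) else 0)
      ≤ ∑ v, μ 0 v * G (update z 0 v, D) := by
    simp_rw [hGv]
    calc (1 - θ) * (t / m) * p * ∑ r : Fin m, (if (κ r).succ ∈ D then (1 : ℝ) else 0)
        = (1 - θ) * (t / m) * ∑ r : Fin m, p * (if (κ r).succ ∈ D then (1 : ℝ) else 0) := by
          rw [Finset.mul_sum, Finset.mul_sum]; exact sum_congr rfl fun r _ => by ring
      _ ≤ (1 - θ) * (t / m) * ∑ r : Fin m, (∑ v, μ 0 v * α r (update z 0 v)) * (if (κ r).succ ∈ D then (1 : ℝ) else 0) :=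
          mul_le_mul_of_nonneg_left (sum_le_sum fun r _ => mul_le_mul_of_nonneg_right
            (sum_redraw_accept_ge_dom κ φ hμ hμ1 hα hdom r z) (by split_ifs <;> norm_num))
            (mul_nonneg (sub_nonneg.mpr hθ1) (div_nonneg ht0 (Nat.cast_nonneg _)))
      _ = ∑ v, μ 0 v * ((1 - θ) * (t / m) * ∑ r : Fin m, α r (update z 0 v) * (if (κ r).succ ∈ D then (1 : ℝ) else 0)) := by
          simp_rw [Finset.sum_mul, Finset.mul_sum]
          rw [Finset.sum_comm]
          exact sum_congr rfl fun v _ => sum_congr rfl fun r _ => by ring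
  calc (1 - t) * w 0 * ((1 - θ) * (t / m) * p * ∑ r : Fin m, (if (κ r).succ ∈ D then (1 : ℝ) else 0))
      ≤ (1 - t) * w 0 * ∑ v, μ 0 v * G (update z 0 v, D) := mul_le_mul_of_nonneg_left havg (mul_nonneg (by linarith) (hw0 0))
    _ = ∑ b : (Fin (K + 1) → S) × Finset (Fin (K + 1)),
          (1 - t) * w 0 * (coordKernel M 0 z b.1 * (if b.2 = D then (1 : ℝ) else 0)) * G b := hred.symm
    _ ≤ ∑ b, Ph (z, D) b * G b := sum_le_sum fun b _ => mul_le_mul_of_nonneg_right (hbranch b) (hG0 b)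

end AvgStale

end Summit.Ventures.LatticeQCDFlow.Scaling

end
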